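import Summits.QuantumFields.YangMills.Theorems.VirialFluxGapFixGenericPointwise
import Summits.QuantumFields.YangMills.Theorems.VirialFluxGapConjugationKernelFixSix
import Summits.QuantumFields.YangMills.Theorems.VirialFluxGapCentralKernelTwelve
import HarnessLib

/-!
# Route `VirialFluxGap` ∕ `SwapVirialDeficit` (YangMills): the generic-region divergence package with SIX kernel vectors —
# (E2) `½tr(A⁻¹H) − … ≤ ½(#ι − 6) + …`, i.e. the generic Euler field `2X_g` has divergence `18L⁴ − 3 + o(1)` (upgrade (U3) of the (P) road to ⟨24196⟩)

LEAD ym-line-sfw-p2 g97 (cell ym-idea-1, free hands; `--supports stmt-QuantumFields-24196`).  The (P) road to the window crux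
⟨24196⟩ `SwapVirialDeficit.ToronSoftnessSharp` reruns the ⟨24141⟩ `PeriodicSoftness` machine with the SHARP count: the landed
✓`fix_generic_divergence_upper` (fcl-p3 g40) used w2's FOUR orthonormal sheet kernel vectors (✓`exists_four_orthonormal_kernel_vectors`) and
gives `½(#ι − 4) + …`; with the two global-conjugation kernel vectors of ✓`exists_six_orthonormal_kernel_vectors` (this seat, ✓p828628) the same
master estimate ✓`generic_divergence_upper` (parametric in the number `m` of kernel vectors) gives `½(#ι − 6) + …`:

* §1 ★ `exists_six_orthonormal_kernel_vectors_of_axis` — the non-centrality hypothesis `hreg` of ✓`exists_six_orthonormal_kernel_vectors` REMOVED: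
  at a CENTRAL comb ring (all `th k = 0`, `tc = 0`) the first six of w3's ✓`exists_twelve_orthonormal_kernel_vectors_central` serve;
* §2 ★★★ `fix_generic_divergence_upper_six` — ✓`fix_generic_divergence_upper` VERBATIM with `(#ι − 4)` → `(#ι − 6)` and `4·s̄/(s̄+λ⋆)` → `6·s̄/(s̄+λ⋆)`
  (same hypotheses: slice-0 tree links `1`, `ρ`-regular, `224L²√F₀(P) < ρ`, trilinear constant `K`, `λ⋆ > 0`, smallness `K#ι√(#ιD) ≤ λ⋆/2`).

With `#ι = 18L⁴ + 3` (✓`card_fixVar_mul_three`) the generic field `2X_g` has divergence `≤ 18L⁴ − 3 + o(1)`, matching the sharp central budget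
✓`centralDiv_le_budget` (`18L⁴ − 3 + 12ρ′²`); fed through the ⟨24141⟩ assembly with `δ`-dependent parameters and ✓`gibbsMeanWindow_of_eulerFieldFixFamily`
this is the (P) road to ⟨24196⟩ (✓`toronSoftnessSharp_of_eulerFieldFixFamily`).  HONEST LABEL: pointwise package only; the `δ`-rerun of the assembly
(cut-offs, central charts, patching, closing arithmetic) is NOT here; ⟨24196⟩ ∕ ⟨24194⟩ ∕ ⟨24197⟩ OPEN; own crux ⟨22884⟩ OPEN (blocked-on ⟨19935⟩); the
Yang–Mills mass gap is NOT proved; no summit is proved by a line.  THEOREMS ONLY (0 `def`, 0 `sorry`), standard axioms.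
References: [cite: Luscher1983, §2]; [folklore].
-/

set_option autoImplicit false

noncomputable section

open scoped Matrix BigOperators ContDiff Topology Quaternion
open MeasureTheory Set Matrix
open Literature.MathematicalPhysics.QuantumFieldTheory hiding SU2
open Literature.MathematicalPhysics.QuantumLattice
open Literature.MathematicalPhysics.QuantumFieldTheory.SUNBakryEmery (expSU coe_expSU)

namespace Summit.QuantumFields.YangMills.Theorems.VirialFluxGap.FrameHessian

open Summit.QuantumFields.YangMills.Theorems.FemtoTransferGap
open Summit.QuantumFields.YangMills.Theorems.FemtoTransferGap.TT
open Summit.QuantumFields.YangMills.Theorems.FemtoTransferGap.TwoLattice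
open Summit.QuantumFields.YangMills.Theorems.FemtoTransferGap.TwoLattice.Flat
open Summit.QuantumFields.YangMills.Theorems.VirialFluxGap.RingDeficit
open Summit.QuantumFields.YangMills.Theorems.VirialFluxGap.FrameDerivative
open Summit.QuantumFields.YangMills.Theorems.VirialFluxGap.ResolventField
open Summit.QuantumFields.YangMills.Theorems.VirialFluxGap.RegularValley
open Summit.QuantumFields.YangMills.Theorems.VirialFluxGap.FixFrame

variable {L : ℕ} [NeZero L]

open scoped Matrix.Norms.Frobenius

/-! ## §1 Six orthonormal kernel vectors at ANY comb ring on an axis -/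

/-- ★ **Six orthonormal exact kernel vectors at a comb ring with data on an axis `n ≠ 0` — no non-centrality hypothesis.**  If some datum is
non-central this is ✓`exists_six_orthonormal_kernel_vectors` (four sheets + two global conjugations); at a CENTRAL comb ring (all `th k = 0`,
`tc = 0`) the first six of the twelve block vectors of ✓`exists_twelve_orthonormal_kernel_vectors_central` serve. [cite: Luscher1983, §2] [folklore] -/
theorem exists_six_orthonormal_kernel_vectors_of_axis (n₁ n₂ n₃ : ℝ) (hn : 0 < n₁ ^ 2 + n₂ ^ 2 + n₃ ^ 2) {h' : Fin 3 → SU2} {c' : SU2}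
    {th : Fin 3 → ℝ} {tc : ℝ}
    (hh' : ∀ j, (su2Quat (h' j)).imI = th j * n₁ ∧ (su2Quat (h' j)).imJ = th j * n₂ ∧ (su2Quat (h' j)).imK = th j * n₃)
    (hc' : (su2Quat c').imI = tc * n₁ ∧ (su2Quat c').imJ = tc * n₂ ∧ (su2Quat c').imK = tc * n₃) :
    ∃ k : Fin 6 → FixVar L × Fin 3 → ℝ, (∀ a b, k a ⬝ᵥ k b = if a = b then 1 else 0) ∧
      (∀ a, frameHessRaw (L := L) fixFrameStd (ringCoord L (((fun _ => combFlat h'), fun _ => c') :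
          (Fin (2 * L - 1 + 1) → GaugeConfig 3 L SU2) × (Site 3 L → SU2))) *ᵥ k a = 0) ∧
      ∀ a, frameHess (L := L) fixFrameStd (ringCoord L (((fun _ => combFlat h'), fun _ => c') :
          (Fin (2 * L - 1 + 1) → GaugeConfig 3 L SU2) × (Site 3 L → SU2))) *ᵥ k a = 0 := by
  by_cases hreg : (∃ k, th k ≠ 0) ∨ tc ≠ 0
  · exact exists_six_orthonormal_kernel_vectors n₁ n₂ n₃ hn hh' hc' hreg
  · push Not at hreg
    obtain ⟨hth, htc⟩ := hreg
    have him : ∀ j, (su2Quat (h' j)).imI = 0 ∧ (su2Quat (h' j)).imJ = 0 ∧ (su2Quat (h' j)).imK = 0 := fun j => by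
      obtain ⟨e1, e2, e3⟩ := hh' j
      rw [e1, e2, e3, hth j]
      exact ⟨zero_mul _, zero_mul _, zero_mul _⟩
    have hcim : (su2Quat c').imI = 0 ∧ (su2Quat c').imJ = 0 ∧ (su2Quat c').imK = 0 := by
      obtain ⟨e1, e2, e3⟩ := hc'
      rw [e1, e2, e3, htc]
      exact ⟨zero_mul _, zero_mul _, zero_mul _⟩
    obtain ⟨k, hon, hraw, hsym⟩ := exists_twelve_orthonormal_kernel_vectors_central (L := L) him hcim
    refine ⟨fun a => k (Fin.castLE (by norm_num) a), fun a b => ?_, fun a => hraw _, fun a => hsym _⟩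
    rw [hon]
    by_cases hab : a = b
    · subst hab; simp
    · have : Fin.castLE (by norm_num : 6 ≤ 12) a ≠ Fin.castLE (by norm_num) b := fun h => hab (Fin.castLE_injective _ h)
      rw [if_neg this, if_neg hab]

/-! ## §2 (E2) with six kernel vectors -/

/-- ★★★ **(E2) THE DIVERGENCE BOUND at a regular small-deficit point of `X_fix`, SIX kernel vectors.**  Same hypotheses as
✓`fix_generic_divergence_upper`; conclusion with `½(#ι − 6)` and `6·s̄/(s̄ + λ⋆)` in place of `½(#ι − 4)` and `4·s̄/(s̄ + λ⋆)`:
the generic Euler field `2X_g` has divergence `≤ 18L⁴ − 3 + o(1)`. [cite: Luscher1983, §2] [folklore] -/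
theorem fix_generic_divergence_upper_six [DecidableEq (FixVar L × Fin 3)] (P : ((Fin (2 * L - 1 + 1) → GaugeConfig 3 L SU2) × (Site 3 L → SU2)))
    (hP : ∀ e : Edge 3 L, treeEdge e = true → P.1 0 e = 1) {ρ : ℝ} (hρ : 0 < ρ)
    (hfar : (∃ k : Fin 3, ρ ^ 2 ≤ 1 - (su2Quat (wrapReps (P.1 0) k)).re ^ 2) ∨ ρ ^ 2 ≤ 1 - (su2Quat (P.2 0)).re ^ 2)
    (hsmall : 224 * (L : ℝ) ^ 2 * Real.sqrt (ringDeficit L (fun _ => false) P) < ρ)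
    {K lam : ℝ} (hK : 0 ≤ K) (hlam : 0 < lam)
    (hK3 : ∀ (Y₁ Y₂ Y₃ : ((Fin (2 * L - 1 + 1) × Edge 3 L) ⊕ Site 3 L) → Matrix (Fin 2) (Fin 2) ℂ) (b₁ b₂ b₃ : ℝ), 0 ≤ b₁ → 0 ≤ b₂ → 0 ≤ b₃ →
      (∀ w, ‖Y₁ w‖ ≤ b₁) → (∀ w, ‖Y₂ w‖ ≤ b₂) → (∀ w, ‖Y₃ w‖ ≤ b₃) → ∀ Q : ((Fin (2 * L - 1 + 1) → GaugeConfig 3 L SU2) × (Site 3 L → SU2)),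
      |frameD Y₁ (frameD Y₂ (frameD Y₃ (ringPoly L))) (ringCoord L Q)| ≤ K * b₁ * b₂ * b₃)
    (hsmall2 : K * Real.sqrt (Fintype.card (FixVar L × Fin 3) * (1032960 * (L : ℝ) ^ 8 * ringDeficit L (fun _ => false) P / ρ ^ 2)) *
      Fintype.card (FixVar L × Fin 3) ≤ lam / 2) :
    (1 / 2) * Matrix.trace ((frameHess (L := L) fixFrameStd (ringCoord L P) + lam • (1 : Matrix (FixVar L × Fin 3) (FixVar L × Fin 3) ℝ))⁻¹ *
          frameHess (L := L) fixFrameStd (ringCoord L P)) -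
        (1 / 2) * ∑ i, ((frameHess (L := L) fixFrameStd (ringCoord L P) + lam • (1 : Matrix (FixVar L × Fin 3) (FixVar L × Fin 3) ℝ))⁻¹ *ᵥ
          ((fun j' k => frameD (fixFrameStd i) (fun M => frameHess (L := L) fixFrameStd M j' k) (ringCoord L P)) *ᵥ
            ((frameHess (L := L) fixFrameStd (ringCoord L P) + lam • (1 : Matrix (FixVar L × Fin 3) (FixVar L × Fin 3) ℝ))⁻¹ *ᵥ
              frameGrad (L := L) fixFrameStd (ringCoord L P)))) i ≤
      (1 / 2) * ((Fintype.card (FixVar L × Fin 3) : ℝ) - 6) +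
        (1 / 2) * (6 * ((K * Real.sqrt (Fintype.card (FixVar L × Fin 3) * (1032960 * (L : ℝ) ^ 8 * ringDeficit L (fun _ => false) P / ρ ^ 2)) *
            Fintype.card (FixVar L × Fin 3)) /
          (K * Real.sqrt (Fintype.card (FixVar L × Fin 3) * (1032960 * (L : ℝ) ^ 8 * ringDeficit L (fun _ => false) P / ρ ^ 2)) *
            Fintype.card (FixVar L × Fin 3) + lam))) +
        (1 / 2) * ((Fintype.card (FixVar L × Fin 3) : ℝ) * (((Fintype.card (FixVar L × Fin 3) : ℝ) * K) / (lam / 2)) *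
          Real.sqrt (3 * ((1 + lam ^ 2 / (lam / 2) ^ 2) * (1032960 * (L : ℝ) ^ 8 * ringDeficit L (fun _ => false) P / ρ ^ 2) +
            (2 * K * (Fintype.card (FixVar L × Fin 3) : ℝ) * Real.sqrt (Fintype.card (FixVar L × Fin 3))) ^ 2 *
              (1032960 * (L : ℝ) ^ 8 * ringDeficit L (fun _ => false) P / ρ ^ 2) ^ 2 / (lam / 2) ^ 2))) := by
  classical
  obtain ⟨n₁, n₂, n₃, th, tc, h', c', u, hn, hh', hc', hp0, hPu, huu⟩ := exists_fixChart_of_regular P hP hρ hfar hsmall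
  set F := ringDeficit L (fun _ => false) P with hF
  set D := 1032960 * (L : ℝ) ^ 8 * F / ρ ^ 2 with hD
  set c : ℝ := (Fintype.card (FixVar L × Fin 3) : ℝ) with hc
  have hF0 : 0 ≤ F := ringDeficit_nonneg _ _
  have hL0 : (0 : ℝ) < L := by exact_mod_cast NeZero.pos L
  have hD0 : 0 ≤ D := by rw [hD]; positivity
  have hc0 : 0 ≤ c := Nat.cast_nonneg _
  have huD : u ⬝ᵥ u ≤ D := huu
  have hp : ringDeficit L (fun _ => false) (P * multiCurve (dirOf fixFrameStd u) (dirOf_conjTranspose fixFrameStd_conjTranspose u)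
      (dirOf_trace fixFrameStd_trace u) 1) = 0 := by rw [hPu]; exact hp0
  have hl1 : ∑ j, |u j| ≤ Real.sqrt (c * D) := sum_abs_le_sqrt u huD
  have hl0 : 0 ≤ ∑ j, |u j| := Finset.sum_nonneg fun j _ => abs_nonneg _
  have hsm : K * (∑ j, |u j|) * Fintype.card (FixVar L × Fin 3) ≤ lam / 2 :=
    le_trans (mul_le_mul_of_nonneg_right (mul_le_mul_of_nonneg_left hl1 hK) hc0) hsmall2
  -- the six orthonormal kernel vectors at the comb base point
  have hn0 : 0 < n₁ ^ 2 + n₂ ^ 2 + n₃ ^ 2 := by rw [hn]; exact one_pos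
  obtain ⟨k, hon, hkraw, -⟩ := exists_six_orthonormal_kernel_vectors_of_axis (L := L) n₁ n₂ n₃ hn0 hh' hc'
  have hker : ∀ a, frameHessRaw (L := L) fixFrameStd (ringCoord L (P * multiCurve (dirOf fixFrameStd u)
      (dirOf_conjTranspose fixFrameStd_conjTranspose u) (dirOf_trace fixFrameStd_trace u) 1)) *ᵥ k a = 0 := by
    intro a; rw [hPu]; exact hkraw a
  have hb : 0 ≤ c * K := mul_nonneg hc0 hK
  have hB := fun i v => frameHess_frameDeriv_sq_le (L := L) (τ := fixFrameStd) norm_fixFrameStd_le hK hK3 P i v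
  have key := generic_divergence_upper (L := L) (τ := fixFrameStd) fixFrameStd_conjTranspose fixFrameStd_trace norm_fixFrameStd_le u P hp
    hK hlam hK3 hsm k hon hker (fun i => fun j' k => frameD (fixFrameStd i) (fun M => frameHess (L := L) fixFrameStd M j' k) (ringCoord L P))
    hb hB
  -- weaken the `u`-dependent terms to `D`
  set s := K * (∑ j, |u j|) * Fintype.card (FixVar L × Fin 3) with hs
  set s' := K * Real.sqrt (c * D) * Fintype.card (FixVar L × Fin 3) with hs'
  have hs0 : 0 ≤ s := by rw [hs]; positivity
  have hss' : s ≤ s' := mul_le_mul_of_nonneg_right (mul_le_mul_of_nonneg_left hl1 hK) hc0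
  have h1 : s / (s + lam) ≤ s' / (s' + lam) := div_add_mono hs0 hss' hlam
  have huu0 : 0 ≤ u ⬝ᵥ u := dpnn u
  have h2 : Real.sqrt (3 * ((1 + lam ^ 2 / (lam / 2) ^ 2) * (u ⬝ᵥ u) + (2 * K * c * Real.sqrt c) ^ 2 * (u ⬝ᵥ u) ^ 2 / (lam / 2) ^ 2)) ≤
      Real.sqrt (3 * ((1 + lam ^ 2 / (lam / 2) ^ 2) * D + (2 * K * c * Real.sqrt c) ^ 2 * D ^ 2 / (lam / 2) ^ 2)) := by
    apply Real.sqrt_le_sqrt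
    have hsq : (u ⬝ᵥ u) ^ 2 ≤ D ^ 2 := pow_le_pow_left₀ huu0 huD 2
    have ha : (1 + lam ^ 2 / (lam / 2) ^ 2) * (u ⬝ᵥ u) ≤ (1 + lam ^ 2 / (lam / 2) ^ 2) * D := mul_le_mul_of_nonneg_left huD (by positivity)
    have hb' : (2 * K * c * Real.sqrt c) ^ 2 * (u ⬝ᵥ u) ^ 2 / (lam / 2) ^ 2 ≤ (2 * K * c * Real.sqrt c) ^ 2 * D ^ 2 / (lam / 2) ^ 2 :=
      div_le_div_of_nonneg_right (mul_le_mul_of_nonneg_left hsq (by positivity)) (by positivity)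
    linarith
  have h3 : (1 / 2) * (c * (c * K / (lam / 2)) *
        Real.sqrt (3 * ((1 + lam ^ 2 / (lam / 2) ^ 2) * (u ⬝ᵥ u) + (2 * K * c * Real.sqrt c) ^ 2 * (u ⬝ᵥ u) ^ 2 / (lam / 2) ^ 2))) ≤
      (1 / 2) * (c * (c * K / (lam / 2)) *
        Real.sqrt (3 * ((1 + lam ^ 2 / (lam / 2) ^ 2) * D + (2 * K * c * Real.sqrt c) ^ 2 * D ^ 2 / (lam / 2) ^ 2))) :=
    mul_le_mul_of_nonneg_left (mul_le_mul_of_nonneg_left h2 (by positivity)) (by norm_num)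
  have h4 : (1 / 2) * ((6 : ℕ) * (s / (s + lam))) ≤ (1 / 2) * (6 * (s' / (s' + lam))) := by
    push_cast
    exact mul_le_mul_of_nonneg_left (mul_le_mul_of_nonneg_left h1 (by norm_num)) (by norm_num)
  have h5 : (1 / 2) * (c - (6 : ℕ)) = (1 / 2) * (c - 6) := by push_cast; ring
  rw [h5] at key
  linarith [key, h3, h4]

end Summit.QuantumFields.YangMills.Theorems.VirialFluxGap.FrameHessian

end
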